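import Literature.NumberTheory.LFunctions.TrilinearKloostermanFractionsReciprocity
import Literature.NumberTheory.LFunctions.TrilinearKloostermanFractionsDiagonal
import HarnessLib

/-!
# Trilinear forms with Kloosterman fractions: the named fact from the off-diagonal bound alone

Topic `NumberTheory/LFunctions`.  S. Bettin, V. Chandee, *Trilinear forms with Kloosterman
fractions*, Adv. Math. 328 (2018): with §3 (the diagonal terms, (3.5)) now PROVED for the
general-`A`, twisted amplified moment (`BC_diagA_bound`, `TrilinearKloostermanFractionsDiagonal.lean`),
the reduction `BettinChandee2018_trilinearKloostermanFractions_of_diagA_offA`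
(`TrilinearKloostermanFractionsReciprocity.lean`: §§2, 5, 6, 7 and Remark 2) leaves exactly §4
(the off-diagonal terms, (4.25)) of the source:

* **`BettinChandee2018_trilinearKloostermanFractions_of_offA`** — the named fact
  `BettinChandee2018_trilinearKloostermanFractions` from the (4.25)-type bound `hO` for the
  general-`A`, twisted, amplified off-diagonal `∑_m Off_m(c)` with a fixed squarefull `b`.

No new named facts (D-0026).

## References

* S. Bettin, V. Chandee, Adv. Math. 328 (2018) 1234–1262 (arXiv:1502.00769), Theorem 1, §§2–7,
  (3.5), (4.25). [BettinChandee2018]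
-/

noncomputable section

open Finset Real

namespace Literature.NumberTheory.LFunctions

/-- **The named fact from the off-diagonal bound (4.25)** for the general-`A`, twisted,
amplified moment with a fixed squarefull `b` (everything else of the source — §§2, 3, 5, 6, 7,
Remark 2, the appendix — being proved in the tree): the hypothesis `hO` is the bound (4.25),
`∑_m Off_m(c) ≪ ‖γ‖²‖ν‖² x^ε W b^{1/2} A L N'^{3/4} (b^{1/4} N'^{1/2} L^{1/2} M^{-1/2} + L^{5/2} N'/M + N'^{1/4} A^{-1/2})`.
[cite: BettinChandee2018, Theorem 1 and (4.25)] -/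
theorem BettinChandee2018_trilinearKloostermanFractions_of_offA
    (hO : ∀ ε : ℝ, 0 < ε → ∃ K : ℝ, 0 < K ∧ ∀ (b : ℕ), 0 < b → (∀ p ∈ b.primeFactors, p ^ 2 ∣ b) →
      ∀ (M N' A : ℝ), 1 / 2 ≤ M → 1 / 2 ≤ N' → (b : ℝ) ≤ N' → (b : ℝ) * N' ≤ M → 1 / 2 ≤ A →
      ∀ (ϑ : ℤ), ϑ ≠ 0 → b.Coprime ϑ.natAbs → ∀ (η : ℝ) (γ ν : ℕ → ℂ),
        (∀ n : ℕ, γ n ≠ 0 → N' < n ∧ (n : ℝ) ≤ 2 * N') →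
        (∀ n : ℕ, γ n ≠ 0 → Squarefree n ∧ n.Coprime b ∧ n.Coprime ϑ.natAbs) →
        (∀ a : ℕ, ν a ≠ 0 → A < a ∧ (a : ℝ) ≤ 2 * A) →
        ∀ L : ℕ, 1 ≤ L →
        ‖∑ m ∈ (Ioc ⌊M⌋₊ ⌊2 * M⌋₊).filter (fun m => m.Coprime b), ∑ ℓ₁ ∈ ((Ioc L (2 * L)).filter (fun ℓ => ℓ.Prime ∧ ℓ.Coprime b ∧ ℓ.Coprime ϑ.natAbs)), ∑ n₁ ∈ Icc 1 ⌊2 * N'⌋₊,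
          ∑ ℓ₂ ∈ ((Ioc L (2 * L)).filter (fun ℓ => ℓ.Prime ∧ ℓ.Coprime b ∧ ℓ.Coprime ϑ.natAbs)), ∑ n₂ ∈ Icc 1 ⌊2 * N'⌋₊,
            (if ℓ₁ * n₁ = ℓ₂ * n₂ then 0 else
            (if (ℓ₂ * n₂).Coprime m ∧ ((ℓ₁ * n₁ : ℕ) : ZMod m) = ((ℓ₂ * n₂ : ℕ) : ZMod m) then
              (γ n₁ * ∑ a ∈ Icc 1 ⌊2 * A⌋₊, ν a * Complex.exp (2 * Real.pi * Complex.I *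
                ((ϑ : ℂ) * (a : ℂ) * ((((m : ZMod (b * n₁))⁻¹).val : ℕ) : ℂ) / ((b * n₁ : ℕ) : ℂ) +
                  (η : ℂ) * (a : ℂ) / ((m : ℂ) * ((b * n₁ : ℕ) : ℂ))))) *
              (starRingEnd ℂ) (γ n₂ * ∑ a ∈ Icc 1 ⌊2 * A⌋₊, ν a * Complex.exp (2 * Real.pi * Complex.I *
                ((ϑ : ℂ) * (a : ℂ) * ((((m : ZMod (b * n₂))⁻¹).val : ℕ) : ℂ) / ((b * n₂ : ℕ) : ℂ) +
                  (η : ℂ) * (a : ℂ) / ((m : ℂ) * ((b * n₂ : ℕ) : ℂ))))) else 0))‖ ≤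
          K * (∑ n ∈ Icc 1 ⌊2 * N'⌋₊, ‖γ n‖ ^ 2) * (∑ a ∈ Icc 1 ⌊2 * A⌋₊, ‖ν a‖ ^ 2) *
            ((1 + |(ϑ : ℝ)| + |η|) * ((b : ℝ) * M * N' * A)) ^ ε * (1 + (|(ϑ : ℝ)| + |η|) * A / ((b : ℝ) * N' * M)) *
            ((b : ℝ) ^ (1 / 2 : ℝ) * A * (L : ℝ) * N' ^ (3 / 4 : ℝ) *
              ((b : ℝ) ^ (1 / 4 : ℝ) * N' ^ (1 / 2 : ℝ) * (L : ℝ) ^ (1 / 2 : ℝ) * M ^ (-(1 / 2) : ℝ) +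
                (L : ℝ) ^ (5 / 2 : ℝ) * N' / M + N' ^ (1 / 4 : ℝ) * A ^ (-(1 / 2) : ℝ))))
    : BettinChandee2018_trilinearKloostermanFractions :=
  BettinChandee2018_trilinearKloostermanFractions_of_diagA_offA BC_diagA_bound hO

end Literature.NumberTheory.LFunctions

end
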